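import Mathlib
import HarnessLib
import HarnessLib.Audit
import Summits.AnomalousDissipation.Statement

/-!
Route: ClockedKolmogorov

CLOSED (retired) 2026-08-15T13:36:04Z by operator:999:1090267 — reason: not-a-thesis: assembly does not conclude the sub-problem Statement — note: D-0027 §2.1 audit (human 2026-08-15: routes that do not decide the summit are removed): the assembly concludes `Literature.Analysis.FluidPDE.ZerothLawTimePeriodic`, not the sub-problem statement; a NEW conforming route may be opened from the same idea (generated `closes : … → _root_.AnomalousDissipa. The file is kept as the record of this route; refuted decls are indexed as negative knowledge (`ledger negatives`).

MILESTONE ROUTE (card inertia-limited-clock-s03-quadrature-stress) to the registered OPEN statement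
turb.S03 =
Literature.Analysis.FluidPDE.ZerothLawTimePeriodic (zeroth law with a smooth time-periodic
nu-INDEPENDENT force; Brue-De Lellis
Q2.1 in long-time form). S03 is NECESSARY for the summit (AnomalousDissipation ->
ZerothLawTimePeriodic is the closed item
InterimFluidKinetic.ZerothLawTimePeriodicStmt), so the Assembly of this route ends in
ZerothLawTimePeriodic, not in
AnomalousDissipation: a proof settles the last open rung below the summit for a fixed force, a
refutation of the negative twin's
universal form would be the first nu-independent-force no-go. This is deliberate and flagged for
refuters.

Thesis X (words). Drive NS on T^3 by the CLOCKED KOLMOGOROV FORCE f(t,x) = F cos(omega t) sin(2 pi m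
x_2) e_1 (smooth,
2pi/omega-periodic, div-free, mean-zero, nu-independent). Inertia, not viscosity, bounds the driven
flow: the exact laminar
response a_nu(t) sin(2 pi m x_2) e_1 has energy <= F^2/(4 omega^2) uniformly in nu (support
OscillatingKolmogorovLaminar), so the
runaway obstruction of the steady problem is absent. Testing the weak formulation against sin(2 pi m
x_2) e_1 and integrating
by parts against the clock gives the exact QUADRATURE WORK IDENTITY
  <(f,u)> = (F/omega) [ <sin(omega t) T(t)> + nu (2 pi m)^2 <sin(omega t) A(t)> ] ,
A(t) = int sin(2 pi m x_2) u_1 dx (forced-mode amplitude), T(t) = -(2 pi m) int cos(2 pi m x_2) u_1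
u_2 dx (Reynolds-stress
pairing with the profile shear = (B(u,u), sin e_1)). Hence S03 for this class is ONE-SIDED: it needs
only a FLOOR on the
component of the turbulent shear stress in phase with the clock (positive cycle-averaged eddy
damping of one mode), plus
"loud families do not run away". X := ClockedKolmogorovZerothLaw (S03 specialised to this force:
some F, omega, m, nu_j -> 0,
global Leray-Hopf u_j, bounded limsup-mean energy, limsup-mean dissipation >= eps > 0).

It suffices to show (two layers; glue CruxesGiveTarget, TargetGivesS03 filed as support):
 C1 (crux, rank 2) QuadratureStressFloor: EXISTS F, omega, m, nu_j -> 0 and mean-zero-data global LH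
solutions with no LH
    leakage in the mean and eps0 <= limsup-mean of sin(omega t) T_j(t) for all j.
 C2 (crux, rank 3) LoudFamiliesStayBounded: EVERY such loud family has sup_j limsup-mean energy <
infinity (no runaway streaming).
 C3 (crux, rank 4, negative twin) ClockDecorrelation: along every bounded-energy family limsup_j
limsup-mean sin(omega t) T_j <= 0.
 Supports: ForceAdmissible, QuadratureWorkIdentity (LH level, Cesaro means, o(1) boundary terms),
OscillatingKolmogorovLaminar,
 PlanarStageBound (x_3-invariant classical solutions: meanDissipation <= nu (2 pi m)^2 meanEnergy -
the planar stage is quiet).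
Lean: Assembly := QuadratureStressFloor -> LoudFamiliesStayBounded -> QuadratureWorkIdentity ->
ForceAdmissible ->
Literature.Analysis.FluidPDE.ZerothLawTimePeriodic (all decls of this route file; Sketch.lean rc 0).

Rationale: WHY THIS LINE. Physical analogy with an explicit dictionary (oscillatory Stokes/shear layers:
Re-independent cycle work, wall
stress leading the free stream by 10-30 deg [JensenSumerFredse1989]; here: no wall, the "stress" is
the Reynolds-stress pairing
T(t) with the profile shear, the "phase lead" is the quadrature component <sin(omega t) T>).
Sources: Cheskidov2023 Thm 1.3 /
S1.2 (nearest theorem: nu-DEPENDENT time-periodic forces), BrueDeLellis2023 S2 Q2.1 (nu-independent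
force posed open),
AlexakisDoering2006PLA S3-4 (2-D time-dependent and single-shell no-go: design rule "witnesses must
three-dimensionalise"),
Frenkel1991 / FrenkelZhang1998 (stability of the oscillating Kolmogorov flow: large-scale
negative-eddy-viscosity instability),
MeshalkinSinai1961, YuGirimaji2006 (critical omega/S for growth under periodic shear),
FoiasManleyRosaTemam2001 Ch. V (5.8)
(low-mode equations for weak solutions). What is imported: the inertia-limited exact base state + a
clock-phase bookkeeping
identity; the turbulence content is isolated in ONE sign/size statement about a quadratic statistic
against a KNOWN external phase.
RANKED CRUXES. rank 2 QuadratureStressFloor (hardest, most informative: the in-phase stress floor =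
positive eddy damping of the
forced mode; carries the whole zeroth-law difficulty for this class, incl. the LH no-leakage
clause); rank 3
LoudFamiliesStayBounded (P5 of the card: the only place S03 still touches S01 - an UPPER bound on
rectified streaming; one-sided);
rank 4 ClockDecorrelation (negative twin; a proof must use exact periodicity/nu-independence -
ForceRobust barrier).
WHAT PROVERS CAN CLOSE NOW. ForceAdmissible, OscillatingKolmogorovLaminar (explicit classical
solution, pressure 0; LH via the
proved IsClassicalNSSolutionOn.isGlobalLerayHopf => the honest mean-zero, drift-free
BoundedEnergyFamily for a nu-independent
time-periodic force, cf. Correlation crux BoundedEnergyFamily which is OPEN for steady forces),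
QuadratureWorkIdentity (adapt
AlexakisDoeringProofs.amplitude_mul_eq_of_isGlobalLerayHopf =
IsLerayHopfOn.integral_inner_eq_add_setIntegral with the steady
test field sin(2 pi m x_2) e_1, then 1-D integration by parts against sin(omega t); sup_t ||u(t)|| <
infinity from
energy_ineq_ae + Poincare as in Correlation.AbsorbingBallLHTorus), PlanarStageBound (AD2006 S4 /
TranShepherd2002 S4 /
ConstantinTarfuleaVicol2013 S2 single-shell identity <||grad omega||^2> = k^2 <||omega||^2> +
Cauchy-Schwarz; passive u_3
decays), CruxesGiveTarget (limsup bookkeeping: limsup(X+Y) >= limsup X - limsup|Y|, |mean(sin A)| <=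
(meanEnergy/2)^(1/2),
reindex j >= j0), TargetGivesS03 (tau = 2 pi/omega).
KILL CRITERIA. (k1) ClockDecorrelation proved for all F, omega, m => C1 is false for bounded
families and the card is dead for
this force class (route closes refuted:QuadratureStressFloor unless an unbounded loud family is
exhibited). (k2) A loud family
with limsup-mean energy -> infinity (e.g. an in-phase planar condensate / streaming jet) refutes C2:
planned repair = restate C2
by folding the energy bound into C1 (Target form), route survives thinner. (k3) nu-uniform Lyapunov
STABILITY of the laminar
state for all F (omega, m fixed) would make every family quiet near laminar data but does not refute
C1 (existential in data);
recorded as evidence only. (k4) DNS (m=2, F=1, omega in {1/2,1,2}, nu = 2^-6..2^-11): quadrature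
component <sin T> decaying
like a power of nu while |T| = O(1) => downgrade C1 to suspect-false.
NOT DECOMPOSED YET (deliberately). No split of C1 into "3-D secondary instability every half-cycle"
+ "mixing floor"; no
Floquet/UniformInstability item (not expressible cheaply over the present API, not load-bearing for
the Assembly); no regime
split in omega (quasi-steady omega -> 0 inherits S01; fast clock omega^2 >> F k is linearly stable
by averaging but still
transitional as nu -> 0, BlennerhassettBassom2002, KerczekDavis1974); no statistical-solution
variant. m >= 2 is advice to
witnesses (Meshalkin-Sinai band below the forcing wavenumber; the time-dependent single-shell pincer
of the barrier audit
GravestModeLaminarAttractorTimePincer makes x_3-invariant gravest-mode stages laminar), not a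
clause.
NOVELTY / BARRIERS: see the dedicated fields (searched 2026-08-15: crossref legs;
searchd/OpenAlex/S2/arXiv rate-limited or down).

Novelty: Nearest prior art FOUND (crossref 2026-08-15; searchd rc 75, OpenAlex/S2/arXiv HTTP 429, galaxy
panama queue timeout - recorded):
(i) the base state and its name are in print - Frenkel1991 (doi:10.1063/1.857951, "Stability of an
oscillating Kolmogorov
flow", paywalled, acq-02002) and FrenkelZhang1998 (doi:10.1137/s003613999630527x, large-scale
instability of generalized
oscillating Kolmogorov flows): linear/long-wave stability of the flow driven by a zero-mean
time-periodic sinusoidal force,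
negative-eddy-viscosity large-scale growth - stability theory only, no dissipation-rate statement;
(ii) Cheskidov2023 Thm 1.3
(arXiv:2311.04182): long-time dissipation anomaly with time-periodic but nu-DEPENDENT forces; (iii)
oscillatory shear layers:
KerczekDavis1974 (doi:10.1017/s0022112074000929), BlennerhassettBassom2002
(doi:10.1017/s0022112002001052), JensenSumerFredse1989
(doi:10.1017/s0022112089002302: measured Re-independent cycle work, walls essential); (iv)
turbulence under periodic shear /
modulated forcing: YuGirimaji2006 (doi:10.1017/s0022112006001832), KuczajGeurtsLohse2006
(doi:10.1209/epl/i2005-10486-2),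
BosClarkRubinstein2007 (doi:10.1063/1.2728939) - nonzero-mean modulation or homogeneous shear, no
zeroth-law statement;
(v) in tree: the barrier audit GravestModeLaminarAttractor(TimePincer) records the time-dependent
single-shell pincer
(TranShepherd2002 S4, ConstantinTarfuleaVicol2013 S2) - planar single-shell stages are nu-uniformly
tame whatever the time
dependence. N  [refs: 10.1063/1.857951, 10.1137/s003613999630527x, 10.1017/s0022112074000929, 10.1017/s0022112002001052, 10.1017/s0022112089002302:, 10.1017/s0022112006001832, 10.1209/epl/i2005-10486-2, 10.1063/1.2728939, 2311.04182, doi:10.1063/1.857951, doi:10.1137/s003613999630527x, doi:10.1017/s0022112074000929, doi:10.1017/s0022112002001052, doi:10.1017/s0022112089002302, doi:10.1017/s0022112006001832, doi:10.1209]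

Barriers (technique_class: time-periodic-force inertia-limited-base-state clock-identity): technique_class: time-periodic-force inertia-limited-base-state clock-identity
Literature.Barriers.AnomalousDissipation.Cheskidov2023_thm13_not_forceRobustNoAnomaly: its blocks:
line explicitly covers REFUTATIONS of ZerothLawTimePeriodic by force-robust velocity-level
estimates; so it constrains only the negative twin ClockDecorrelation (rank 4), whose proof must use
the exact periodicity / nu-independence / single-mode structure of f (clock-phase decorrelation does
not survive adding C(R;L^2)-small nu-dependent rough components); the positive items C1, C2 and all
supports are witness-side and not in the blocked class. Cheskidov's loud families are consistent
with the identity (their forces are not single-clock single-mode).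
Literature.Barriers.AnomalousDissipation.AlexakisDoering2006_energyDissipationBound: APPLIES to the
planar stage (scope caveats S3 time-dependent forcing and S4 single-shell: eps <= nu k_f^2 U^2):
every x_3-invariant regime of the clocked Kolmogorov flow is quiet at bounded energy - USED as the
design rule for C1 (witnesses must three-dimensionalise every half-cycle) and FILED as the provable
support PlanarStageBound; the route's witnesses are genuinely 3-D Leray-Hopf families, outside the
planar-reduction class.
Literature.Barriers.AnomalousDissipation.Marchioro1986_globalAttraction: gravest-mode planar
single-shell forcing is laminar-rigid for mean-zero data, and the barrier audit's time-dependent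
pincer (GravestModeLaminarAttractorTimePincer) extends t

Novelty grade: new-combination — ROUTE REVIEW (refuter, 2nd independent pass 2026-08-15; items stamped earlier by refuter-…-20cbd644-0; route grade was missing). VERDICT SURVIVES, no block. (1) REAL-IMPORT ELABORATION: Theses module now built on the farm; import + conjunction of all 11 decls rc0 (W_CK.lean). (2) QuadratureWorkIdent (refuter refuter-rreview-route-HubbardSuperconduc-b0f0368c-0, 2026-08-15T12:09:28Z; prior: arXiv:2311.04182 (Cheskidov2023 Thm 1.3: time-periodic but nu-DEPENDENT forces), BrueDeLellis2023 §2 Q2.1 (nu-independent force posed open), doi:10.1063/1.857951 (Frenkel1991, oscillating Kolmogorov flow: stability only), doi:10.1137/s003613999630527x (FrenkelZhang1998), AlexakisDoering2006PLA §3-4 (time-dependent / single-shell planar no-go), FoiasManleyRosaTemam2001 Ch. V, doi:10.1017/s002211208)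

History (route lifecycle, newest last):
- 2026-08-15T13:36:05Z · CLOSED retired — not-a-thesis: assembly does not conclude the sub-problem Statement (operator:999:1090267)

sub-problem: AnomalousDissipation · status: closed(retired) · opened planner-plancard-AnomalousDissipation-Anomalo-63ad733b-0 2026-08-15T10:56:40Z · rev 1 · ledger route-AnomalousDissipation-ClockedKolmogorov
GENERATED by the gate from the ledger (D-0016/17). Provers cite these decls: `theorem foo : Summit.AnomalousDissipation.AnomalousDissipation.Theses.ClockedKolmogorov.<Decl> := …` in Summits/AnomalousDissipation/AnomalousDissipation/Theorems/<Name>.lean.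
-/

namespace Summit.AnomalousDissipation.AnomalousDissipation.Theses.ClockedKolmogorov

open scoped BigOperators Topology Manifold Classical MeasureTheory ProbabilityTheory Matrix InnerProductSpace ComplexConjugate ContinuousMap
open Filter Set Function TopologicalSpace MeasureTheory

attribute [summit_statement] _root_.AnomalousDissipation

open Literature.Turb

/-- item stmt-AnomalousDissipation-1475 · target · rank 0 · closed · moot by None · by planner
why it might fail: Conjunction of C1 (in-phase stress floor incl. LH no-leakage), C2 (no runaway) and the identity; no fixed-force loud example is known in any class (Cheskidov2023 p.4); recent DNS with smooth box forcing suggest a slowly vanishing anomaly (Iyer-Drivas-Eyink-Sreenivasan arXiv:2504.13298).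
sources: BrueDeLellis2023, Cheskidov2023, 2311.04182, 2504.13298, JensenSumerFredse1989, Frenkel1991
[target] X: turb.S03 specialised to the clocked Kolmogorov force f(t,x) = F cos(omega t) sin(2 pi m
x_2) e_1 on T^3 (profile written as Im mFourier(Pi.single 1 m)): some F, omega > 0, m > 0, nu_j ->
0, global Leray-Hopf u_j for this nu-independent force with sup_j limsup-mean energy < infinity and
limsup-mean dissipation nu_j<||grad u_j||^2> >= eps > 0 (epsilon-form, spectral gradients, limsup
Cesaro means exactly as in Literature.Analysis.FluidPDE.ZerothLawTimePeriodic). X -> S03 is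
TargetGivesS03 (with ForceAdmissible); CruxesGiveTarget derives X from the two cruxes and the
identity. Classical witnesses suffice (IsClassicalNSSolutionOn.isGlobalLerayHopf, energy_eq are
proved). Sources: BrueDeLellis2023 S2 Q2.1; Cheskidov2023 S1.2, Thm 1.3; card
inertia-limited-clock-s03-quadrature-stress. -/
@[route_item "route-AnomalousDissipation-ClockedKolmogorov"]
def ClockedKolmogorovZerothLaw : Prop :=
  ∃ (F ω : ℝ) (m : ℕ), 0 < F ∧ 0 < ω ∧ 0 < m ∧ ∃ (ν : ℕ → ℝ) (u₀ : ℕ → UnitAddTorus (Fin 3) → EuclideanSpace ℝ (Fin 3)) (u : ℕ → ℝ → UnitAddTorus (Fin 3) → EuclideanSpace ℝ (Fin 3)), (∀ j, 0 < ν j) ∧ Filter.Tendsto ν Filter.atTop (nhds 0) ∧ (∀ j, Literature.Analysis.FluidPDE.Torus.IsGlobalLerayHopf (ν j) (fun (t : ℝ) (x : UnitAddTorus (Fin 3)) => (F * Real.cos (ω * t) * (UnitAddTorus.mFourier (Pi.single (1 : Fin 3) (m : ℤ)) x).im) • EuclideanSpace.single (0 : Fin 3) (1 : ℝ)) (u₀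 j) (u j)) ∧ (∃ E : ℝ, ∀ j, Literature.Analysis.FluidPDE.meanEnergy (u j) ≤ E) ∧ ∃ ε : ℝ, 0 < ε ∧ ∀ j, ε ≤ Literature.Analysis.FluidPDE.meanDissipation (ν j) (u j)

/-- item stmt-AnomalousDissipation-1476 · crux · rank 2 · closed · moot by None · by planner
why it might fail: Stress phase may wander w.r.t. the clock so the cycle-mean in-phase part vanishes though |T|=O(1); planar/KH stages are provably quiet (eps <= nu k^2 <|u|^2>, AD2006 S4) so witnesses must 3-dimensionalise each half-cycle; low omega inherits S01; LH no-leakage at O(1) forcing is open (FMRT p.71).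
sources: AlexakisDoering2006PLA, JensenSumerFredse1989, YuGirimaji2006, Frenkel1991, FoiasManleyRosaTemam2001, Cheskidov2023
[crux] C1 (rank 2, the card's P4): EXISTS F, omega > 0, m > 0, nu_j -> 0, mean-zero data u0_j and
global Leray-Hopf u_j of NS_{nu_j} driven by f = F cos(omega t) sin(2 pi m x_2) e_1 such that (a) no
Leray-Hopf leakage in the mean: limsup-mean <(f,u_j)> <= meanDissipation (automatic for classical
witnesses by energy_eq; the reverse inequality always holds), and (b) IN-PHASE STRESS FLOOR: eps0 <=
limsup_T T^-1 int_0^T sin(omega t) T_j(t) dt for all j, where T_j(t) = -(2 pi m) int cos(2 pi m x_2)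
u_{j,1} u_{j,2} dx = (B(u,u), sin(2 pi m x_2) e_1) is the Reynolds-stress pairing with the profile
shear. Physically: positive cycle-averaged eddy damping r_T of the forced mode (T ~ r_T A, A ~ (F/2
omega) sin(omega t) reactive => <sin T> ~ r_T F/(4 omega) > 0). No energy clause here (that is C2).
Advice to witnesses: m >= 2 (Meshalkin-Sinai/Frenkel band below the forcing wavenumber), F k/omega^2
large (quasi-steady KH each half-cycle), and the response must three-dimensionalise every half-cycle
(PlanarStageBound: x_3-invariant stages are quiet). Fastest refutation: DNS m=2, F=1, omega in
{1/2,1,2}, nu=2^-6..2^-11: <sin(omega t)T> decaying like a power of nu while |T| = O(1). Sources: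
Alexaki -/
@[route_item "route-AnomalousDissipation-ClockedKolmogorov"]
def QuadratureStressFloor : Prop :=
  ∃ (F ω : ℝ) (m : ℕ), 0 < F ∧ 0 < ω ∧ 0 < m ∧ ∃ (ν : ℕ → ℝ) (u₀ : ℕ → UnitAddTorus (Fin 3) → EuclideanSpace ℝ (Fin 3)) (u : ℕ → ℝ → UnitAddTorus (Fin 3) → EuclideanSpace ℝ (Fin 3)), (∀ j, 0 < ν j) ∧ Filter.Tendsto ν Filter.atTop (nhds 0) ∧ (∀ j, Literature.Analysis.FunctionSpaces.Torus.HasZeroMean (u₀ j)) ∧ (∀ j, Literature.Analysis.FluidPDE.Torus.IsGlobalLerayHopf (ν j) (fun (t : ℝ) (x : UnitAddTorus (Fin 3)) => (F * Real.cos (ω * t) * (UnitAddTorus.mFourier (Pi.single (1 : Fin 3) (m : ℤ)) x).im) • EuclideanSpace.single (0 : Fin 3) (1 : ℝ)) (u₀ j) (u j)) ∧ (∀ j, Literature.Analysis.FluidPDE.longTimeAvgSup (fun t => ∫ x, inner ℝ ((F * Real.cos (ω * t) * (UnitAddTorus.mFourier (Pi.single (1 : Fin 3) (m : ℤ)) x).im)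 • EuclideanSpace.single (0 : Fin 3) (1 : ℝ)) (u j t x)) ≤ Literature.Analysis.FluidPDE.meanDissipation (ν j) (u j)) ∧ ∃ ε : ℝ, 0 < ε ∧ ∀ j, ε ≤ Literature.Analysis.FluidPDE.longTimeAvgSup (fun t => Real.sin (ω * t) * (-(2 * Real.pi * m) * ∫ x, (UnitAddTorus.mFourier (Pi.single (1 : Fin 3) (m : ℤ)) x).re * (u j t x 0 * u j t x 1)))

/-- item stmt-AnomalousDissipation-1477 · crux · rank 3 · closed · moot by None · by planner
why it might fail: Rectified steady streaming driven by the cycle-mean Reynolds stress may run away like 1/nu (laminar catastrophe one level down); the oscillating Kolmogorov flow has large-scale NEGATIVE-eddy-viscosity instability (Frenkel1991, FrenkelZhang1998); an in-phase planar condensate needs energy ~1/nu.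
sources: Frenkel1991, FrenkelZhang1998, GalletYoung2013, MeshalkinSinai1961, BorueOrszag1996, FoiasManleyRosaTemam2001
[crux] C2 (rank 3, the card's P5 NoRunawayStreaming, universal over LOUD families): for all F, omega
> 0, m > 0 and every vanishing-viscosity family of mean-zero-data global Leray-Hopf solutions of the
clocked Kolmogorov system that has the in-phase stress floor of C1 (same clause verbatim), sup_j
limsup-mean energy < infinity. Content: the driven (clock-frequency) component is bounded
automatically (amplitude <= F/max(omega, r_T) by the mode ODE A' = -T - nu k^2 A + (F/2) cos(omega
t)); what must be shown is that the RECTIFIED steady streaming driven by the cycle-averaged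
Reynolds-stress divergence, and the turbulent fluctuation energy, stay bounded as nu -> 0 - an UPPER
bound only (one-sided), the one place where S03 still touches S01. Planar loud families cannot exist
at bounded energy (PlanarStageBound + 2-D energy equality), so in the x_3-invariant class C2 says
'no loud planar family at all' (a loud planar family needs energy >~ 1/nu). Initial transients are
invisible (limsup in T at fixed j; absorbing ball at fixed nu), mean momentum is excluded by
HasZeroMean u0. Kill/repair: an explicit loud family with energy -> infinity refutes C2; planned
repair = fold the energy bound -/
@[route_item "route-AnomalousDissipation-ClockedKolmogorov"]
def LoudFamiliesStayBounded : Prop :=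
  ∀ (F ω : ℝ) (m : ℕ), 0 < F → 0 < ω → 0 < m → ∀ (ν : ℕ → ℝ) (u₀ : ℕ → UnitAddTorus (Fin 3) → EuclideanSpace ℝ (Fin 3)) (u : ℕ → ℝ → UnitAddTorus (Fin 3) → EuclideanSpace ℝ (Fin 3)), (∀ j, 0 < ν j) → Filter.Tendsto ν Filter.atTop (nhds 0) → (∀ j, Literature.Analysis.FunctionSpaces.Torus.HasZeroMean (u₀ j)) → (∀ j, Literature.Analysis.FluidPDE.Torus.IsGlobalLerayHopf (ν j) (fun (t : ℝ) (x : UnitAddTorus (Fin 3)) => (F * Real.cos (ω * t) * (UnitAddTorus.mFourier (Pi.single (1 : Fin 3) (m : ℤ)) x).im) • EuclideanSpace.single (0 : Fin 3) (1 : ℝ)) (u₀ j) (u j)) → (∃ ε : ℝ, 0 < ε ∧ ∀ j, ε ≤ Literature.Analysis.FluidPDE.longTimeAvgSup (fun t => Real.sin (ω * t) * (-(2 * Real.pi * m) * ∫ x, (UnitAddTorus.mFourier (Pi.single (1 : Fin 3) (m : ℤ)) x).re * (u j t x 0 * u j t x 1)))) → ∃ E : ℝ, ∀ j, Literature.Analysis.FluidPDE.meanEnergy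 (u j) ≤ E

/-- item stmt-AnomalousDissipation-1478 · crux · rank 4 · closed · moot by None · by planner
why it might fail: Likely FALSE if K41 holds: oscillatory shear layers show Re-independent cycle work, stress leading the free stream (JensenSumerFredse1989); modulated-forcing DNS: finite response (KuczajGeurtsLohse2006); any force-robust velocity-level proof is refuted by Cheskidov2023 Thm 1.3 (ForceRobust barrier).
sources: Literature.Barriers.AnomalousDissipation.Cheskidov2023_thm13_not_forceRobustNoAnomaly, JensenSumerFredse1989, KuczajGeurtsLohse2006, BosClarkRubinstein2007, Cheskidov2023
[crux] C3 (rank 4, NEGATIVE TWIN of C1, the card's P6): for all F, omega > 0, m > 0 and every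
vanishing-viscosity family of mean-zero-data global Leray-Hopf solutions of the clocked Kolmogorov
system with bounded limsup-mean energy, limsup_j [limsup-mean_T sin(omega t) T_j(t)] <= 0: the
quadrature component of the Reynolds-stress pairing decorrelates from the clock (no positive part
survives). With C2 it refutes C1; by QuadratureWorkIdentity it gives limsup-mean work -> 0, hence
(MeanEnergyInequality) meanDissipation -> 0 along every bounded family of this force class =
ZerothLawNeg restricted to the clocked Kolmogorov force, the first nu-INDEPENDENT-force no-go if
proved. The energy hypothesis also guards the Real-limsup junk (|limsup-mean sin T_j| <= pi m E). A
proof MUST use the exact time-periodicity / nu-independence / single-mode structure of f: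
force-robust velocity-level arguments are refuted by Cheskidov2023 Thm 1.3 (barrier
Cheskidov2023_thm13_not_forceRobustNoAnomaly). Staff with refuters of C1 first; DNS protocol as in
C1. Sources: Literature.Barriers.AnomalousDissipation.Cheskidov2023_thm13_not_forceRobustNoAnomaly;
JensenSumerFredse1989; KuczajGeurtsLohse2006; BosClar -/
@[route_item "route-AnomalousDissipation-ClockedKolmogorov"]
def ClockDecorrelation : Prop :=
  ∀ (F ω : ℝ) (m : ℕ), 0 < F → 0 < ω → 0 < m → ∀ (ν : ℕ → ℝ) (u₀ : ℕ → UnitAddTorus (Fin 3) → EuclideanSpace ℝ (Fin 3)) (u : ℕ → ℝ → UnitAddTorus (Fin 3) → EuclideanSpace ℝ (Fin 3)), (∀ j, 0 < ν j) → Filter.Tendsto ν Filter.atTop (nhds 0) → (∀ j, Literature.Analysis.FunctionSpaces.Torus.HasZeroMean (u₀ j)) → (∀ j, Literature.Analysis.FluidPDE.Torus.IsGlobalLerayHopf (ν j) (fun (t : ℝ) (x : UnitAddTorus (Fin 3)) => (F * Real.cos (ω * t) * (UnitAddTorus.mFourier (Pi.single (1 : Fin 3) (m : ℤ)) x).im)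 • EuclideanSpace.single (0 : Fin 3) (1 : ℝ)) (u₀ j) (u j)) → (∃ E : ℝ, ∀ j, Literature.Analysis.FluidPDE.meanEnergy (u j) ≤ E) → Filter.limsup (fun j => Literature.Analysis.FluidPDE.longTimeAvgSup (fun t => Real.sin (ω * t) * (-(2 * Real.pi * m) * ∫ x, (UnitAddTorus.mFourier (Pi.single (1 : Fin 3) (m : ℤ)) x).re * (u j t x 0 * u j t x 1)))) Filter.atTop ≤ 0

/-- item stmt-AnomalousDissipation-1479 · support · rank 9 · closed · moot by None · by planner
sources: FlatTorus.lean:591 Torus.isSmooth_mFourier, TorusCalculus.lean:158 Torus.IsDivFree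
[support] The clocked Kolmogorov force f(t,x) = F cos(omega t) Im(mFourier (Pi.single 1 m) x) e_1 =
F cos(omega t) sin(2 pi m x_2) e_1 is admissible for S03: jointly smooth on R x T^3 (stLift is (t,y)
-> F cos(omega t) sin(2 pi m y_2) e_1; Torus.isSmooth_mFourier + Complex.imCLM + ContDiff.mul), 2
pi/omega-periodic in t, divergence free at every t (the only nonzero component depends on x_2 alone:
partialDeriv 0 of a function of x 1 vanishes; cf. DoeringFoiasPowerProofs.isDivFree_fun_const
pattern), mean zero at every t (integral of a nonconstant character vanishes; m = 0 gives f = 0,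
also fine). ~80-120 lines. Sources: folklore; Torus.IsSmoothSpaceTimeOn / IsDivFree / HasZeroMean
defs (TorusCalculus.lean). -/
@[route_item "route-AnomalousDissipation-ClockedKolmogorov"]
def ForceAdmissible : Prop :=
  ∀ (F ω : ℝ) (m : ℕ), 0 < ω → Literature.Analysis.FunctionSpaces.Torus.IsSmoothSpaceTimeOn Set.univ (fun (t : ℝ) (x : UnitAddTorus (Fin 3)) => (F * Real.cos (ω * t) * (UnitAddTorus.mFourier (Pi.single (1 : Fin 3) (m : ℤ)) x).im) • EuclideanSpace.single (0 : Fin 3) (1 : ℝ)) ∧ Function.Periodic (fun (t : ℝ) (x : UnitAddTorus (Fin 3)) => (F * Real.cos (ω * t) * (UnitAddTorus.mFourier (Pi.single (1 : Fin 3) (m : ℤ)) x).im) • EuclideanSpace.single (0 : Fin 3) (1 : ℝ)) (2 * Real.pi / ω) ∧ (∀ t : ℝ, Literature.Analysis.FunctionSpaces.Torus.IsDivFree (fun (x : UnitAddTorus (Fin 3)) => (F * Real.cos (ω * t) * (UnitAddTorus.mFourier (Pi.single (1 : Fin 3) (m : ℤ)) x).im) • EuclideanSpace.single (0 : Fin 3)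 (1 : ℝ))) ∧ ∀ t : ℝ, Literature.Analysis.FunctionSpaces.Torus.HasZeroMean (fun (x : UnitAddTorus (Fin 3)) => (F * Real.cos (ω * t) * (UnitAddTorus.mFourier (Pi.single (1 : Fin 3) (m : ℤ)) x).im) • EuclideanSpace.single (0 : Fin 3) (1 : ℝ))

/-- item stmt-AnomalousDissipation-1480 · support · rank 9 · closed · moot by None · by planner
sources: FoiasManleyRosaTemam2001, AlexakisDoering2006PLA, AlexakisDoeringProofs.lean:597 amplitude_mul_eq_of_isGlobalLerayHopf
[support] QUADRATURE WORK IDENTITY at the Leray-Hopf level (the card's P3). For omega, nu > 0, m >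
0, mean-zero datum and a global LH solution u of the clocked Kolmogorov system: timeMean_T <(f,u)> -
(F/omega)[ timeMean_T (sin(omega t) T(t)) + nu (2 pi m)^2 timeMean_T (sin(omega t) A(t)) ] -> 0 as T
-> infinity, with A(t) = int sin(2 pi m x_2) u_1, T(t) = -(2 pi m) int cos(2 pi m x_2) u_1 u_2.
PROOF PLAN (~300 lines): (1) test the time-sliced weak formulation against the STEADY smooth
div-free field Psi = sin(2 pi m x_2) e_1: IsLerayHopfOn.integral_inner_eq_add_setIntegral (used
verbatim in AlexakisDoeringProofs.amplitude_mul_eq_of_isGlobalLerayHopf) gives A(t) = A(0+) +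
int_0^t [ -T(s) - nu k^2 A(s) + (F/2) cos(omega s) ] ds, since <u,(u.grad)Psi> integrates to (2 pi
m) int cos u_1 u_2 = -T, <u, Lap Psi> = -k^2 <u,Psi>, <f(s),Psi> = F cos(omega s)/2; so A is
absolutely continuous; (2) work density (f(t),u(t)) = F cos(omega t) A(t); (3) multiply the
integrated ODE by omega cos / integrate by parts against sin(omega t) on [0,T]: int_0^T F cos(omega
t) A = (F/omega)[ int sin T_stress + nu k^2 int sin A ] + (F/omega) A(T) sin(omega T) - (F^2/(2
omega)) int_0^T sin cos; (4) divide by T -/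
@[route_item "route-AnomalousDissipation-ClockedKolmogorov"]
def QuadratureWorkIdentity : Prop :=
  ∀ (F ω ν : ℝ) (m : ℕ) (u₀ : UnitAddTorus (Fin 3) → EuclideanSpace ℝ (Fin 3)) (u : ℝ → UnitAddTorus (Fin 3) → EuclideanSpace ℝ (Fin 3)), 0 < ω → 0 < ν → 0 < m → Literature.Analysis.FunctionSpaces.Torus.HasZeroMean u₀ → Literature.Analysis.FluidPDE.Torus.IsGlobalLerayHopf ν (fun (t : ℝ) (x : UnitAddTorus (Fin 3)) => (F * Real.cos (ω * t) * (UnitAddTorus.mFourier (Pi.single (1 : Fin 3) (m : ℤ)) x).im) • EuclideanSpace.single (0 : Fin 3) (1 : ℝ)) u₀ u → Filter.Tendsto (fun T : ℝ => Literature.Analysis.FluidPDE.timeMean (fun t => ∫ x, inner ℝ ((F * Real.cos (ω * t) * (UnitAddTorus.mFourier (Pi.single (1 : Fin 3) (m : ℤ)) x).im) • EuclideanSpace.single (0 : Fin 3) (1 : ℝ)) (u t x)) T - (F / ω) * (Literature.Analysis.FluidPDE.timeMean (fun t => Real.sin (ω * t) * (-(2 * Real.pi * m) * ∫ x, (UnitAddTorus.mFourier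 (Pi.single (1 : Fin 3) (m : ℤ)) x).re * (u t x 0 * u t x 1))) T + ν * (2 * Real.pi * m) ^ 2 * Literature.Analysis.FluidPDE.timeMean (fun t => Real.sin (ω * t) * (∫ x, (UnitAddTorus.mFourier (Pi.single (1 : Fin 3) (m : ℤ)) x).im * u t x 0)) T)) Filter.atTop (nhds 0)

/-- item stmt-AnomalousDissipation-1481 · support · rank 9 · closed · moot by None · by planner
sources: Frenkel1991, TorusClassicalLerayHopfProofs.lean:340 IsClassicalNSSolutionOn.isGlobalLerayHopf
[support] THE INERTIA-LIMITED BASE STATE (the card's P1). For omega, nu > 0, m > 0, k = 2 pi m: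
u_L(t,x) = alpha(t) sin(2 pi m x_2) e_1 with alpha(t) = F (nu k^2 cos(omega t) + omega sin(omega
t))/(omega^2 + nu^2 k^4) (the 2 pi/omega-periodic solution of alpha' = -nu k^2 alpha + F cos(omega
t)) and pressure 0 is a classical solution of NS_nu with the clocked Kolmogorov force on all of R x
T^3 ((u.grad)u = 0 for a parallel flow depending on x_2 only; nu Lap u_L = -nu k^2 u_L),
time-periodic, mean-zero at every t, with kineticEnergy(u_L(t)) = alpha(t)^2/4 <= F^2/(4 omega^2)
UNIFORMLY IN nu (Cauchy-Schwarz: (nu k^2 cos + omega sin)^2 <= omega^2 + nu^2 k^4). Corollaries for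
the taking (not separate items): via the proved IsClassicalNSSolutionOn.isGlobalLerayHopf, u_L is
global Leray-Hopf from u_L(0), so the clocked Kolmogorov force carries a nu-uniformly
BOUNDED-ENERGY, mean-zero, drift-free LH family (the S03 analogue of
Correlation.BoundedEnergyFamily, open for steady forces) which is QUIET: dissipation nu k^2
alpha^2/2 -> 0, work F^2 nu k^2/(4(omega^2+nu^2 k^4)) -> 0, response 90 degrees out of phase
(reactive). ~200 lines (derivatives of alpha(t) sin(2 pi m x_2) e_1 through Torus.t -/
@[route_item "route-AnomalousDissipation-ClockedKolmogorov"]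
def OscillatingKolmogorovLaminar : Prop :=
  ∀ (F ω ν : ℝ) (m : ℕ), 0 < ω → 0 < ν → 0 < m → Literature.Analysis.FunctionSpaces.Torus.IsClassicalNSSolutionOn Set.univ ν (fun (t : ℝ) (x : UnitAddTorus (Fin 3)) => (F * Real.cos (ω * t) * (UnitAddTorus.mFourier (Pi.single (1 : Fin 3) (m : ℤ)) x).im) • EuclideanSpace.single (0 : Fin 3) (1 : ℝ)) (fun (t : ℝ) (x : UnitAddTorus (Fin 3)) => ((F * (ν * (2 * Real.pi * m) ^ 2 * Real.cos (ω * t) + ω * Real.sin (ω * t)) / (ω ^ 2 + ν ^ 2 * ((2 * Real.pi * m) ^ 2) ^ 2)) * (UnitAddTorus.mFourier (Pi.single (1 : Fin 3) (m : ℤ)) x).im) • EuclideanSpace.single (0 : Fin 3) (1 : ℝ)) (fun _ _ => 0) ∧ Function.Periodic (fun (t : ℝ) (x : UnitAddTorus (Fin 3)) => ((F * (ν * (2 * Real.pi * m) ^ 2 * Real.cos (ω * t) + ω * Real.sin (ω * t)) / (ω ^ 2 + ν ^ 2 * ((2 * Real.pi * m) ^ 2) ^ 2)) * (UnitAddTorus.mFourier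 (Pi.single (1 : Fin 3) (m : ℤ)) x).im) • EuclideanSpace.single (0 : Fin 3) (1 : ℝ)) (2 * Real.pi / ω) ∧ (∀ t : ℝ, Literature.Analysis.FunctionSpaces.Torus.HasZeroMean (fun (x : UnitAddTorus (Fin 3)) => ((F * (ν * (2 * Real.pi * m) ^ 2 * Real.cos (ω * t) + ω * Real.sin (ω * t)) / (ω ^ 2 + ν ^ 2 * ((2 * Real.pi * m) ^ 2) ^ 2)) * (UnitAddTorus.mFourier (Pi.single (1 : Fin 3) (m : ℤ)) x).im) • EuclideanSpace.single (0 : Fin 3) (1 : ℝ))) ∧ ∀ t : ℝ, Literature.Analysis.FunctionSpaces.Torus.kineticEnergy (fun (x : UnitAddTorus (Fin 3)) => ((F * (ν * (2 * Real.pi * m) ^ 2 * Real.cos (ω * t) + ω * Real.sin (ω * t)) / (ω ^ 2 + ν ^ 2 * ((2 * Real.pi * m) ^ 2) ^ 2)) * (UnitAddTorus.mFourier (Pi.single (1 : Fin 3) (m : ℤ)) x).im) • EuclideanSpace.single (0 : Fin 3) (1 : ℝ)) ≤ F ^ 2 / (4 * ω ^ 2)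

/-- item stmt-AnomalousDissipation-1482 · support · rank 9 · closed · moot by None · by planner
sources: AlexakisDoering2006PLA, TranShepherd2002, ConstantinTarfuleaVicol2013, Literature.Barriers.AnomalousDissipation.AlexakisDoering2006_energyDissipationBound
[support] THE PLANAR STAGE IS QUIET (design rule behind C1, Alexakis-Doering S4 single-shell case,
any time dependence). For omega, nu > 0, m > 0 and a classical solution (u,p) on [0,infinity) x T^3
of the clocked Kolmogorov system that is x_3-INVARIANT (u(t, x + c e_3) = u(t,x)) with sup_{t>=0}
kineticEnergy < infinity: meanDissipation nu u <= nu (2 pi m)^2 meanEnergy u. PROOF PLAN: u = (v, w)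
with v a 2-D NS flow forced by the single Stokes eigenmode f (-Lap f = k^2 f, k = 2 pi m) and w =
u_3 passively advected-diffused (d_3 p = 0, f_3 = 0). (i) energy and enstrophy balances of v:
d/dt(||omega||^2 - k^2 ||v~||^2)/2 = -nu(||grad omega||^2 - k^2 ||omega||^2) because (curl f, omega)
= k^2 (f, v) (TranShepherd2002 S4 'whether or not the monoscale forcing is time-independent';
ConstantinTarfuleaVicol2013 S2; AlexakisDoering2006PLA S4 (EPDBmono)); enstrophy stays bounded (no
stretching in 2-D), so timeMean ||grad omega||^2 - k^2 timeMean ||omega||^2 -> 0; (ii)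
Cauchy-Schwarz in space-time: timeMean ||omega||^2 = timeMean (v~, -Lap v~) <= (timeMean
||v~||^2)^(1/2) (timeMean ||grad omega||^2)^(1/2), whence limsup-mean ||omega||^2 <= k^2 limsup-mean
||v||^2; (iii) ||grad v||^2 = ||omega|| -/
@[route_item "route-AnomalousDissipation-ClockedKolmogorov"]
def PlanarStageBound : Prop :=
  ∀ (F ω ν : ℝ) (m : ℕ) (u : ℝ → UnitAddTorus (Fin 3) → EuclideanSpace ℝ (Fin 3)) (p : ℝ → UnitAddTorus (Fin 3) → ℝ), 0 < ω → 0 < ν → 0 < m → Literature.Analysis.FunctionSpaces.Torus.IsClassicalNSSolutionOn (Set.Ici 0) ν (fun (t : ℝ) (x : UnitAddTorus (Fin 3)) => (F * Real.cos (ω * t) * (UnitAddTorus.mFourier (Pi.single (1 : Fin 3) (m : ℤ)) x).im) • EuclideanSpace.single (0 : Fin 3) (1 : ℝ)) u p → (∀ (t : ℝ) (c : UnitAddCircle) (x : UnitAddTorus (Fin 3)), u t (x + Pi.single (2 : Fin 3) c) = u t x) → (∃ C : ℝ, ∀ t, 0 ≤ t → Literature.Analysis.FunctionSpaces.Torus.kineticEnergy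 (u t) ≤ C) → Literature.Analysis.FluidPDE.meanDissipation ν u ≤ ν * (2 * Real.pi * m) ^ 2 * Literature.Analysis.FluidPDE.meanEnergy u

/-- item stmt-AnomalousDissipation-1483 · support · rank 9 · closed · moot by None · by planner
sources: FoiasManleyRosaTemam2001
[support] GLUE (layer 1 -> target): QuadratureStressFloor -> LoudFamiliesStayBounded ->
QuadratureWorkIdentity -> ClockedKolmogorovZerothLaw. Plan (~150 lines of limsup bookkeeping): take
F, omega, m and the family from C1; C2 gives E with meanEnergy(u_j) <= E; for each j the identity
gives timeMean W_j = (F/omega)(X_T + Y_T) + o(1) with X_T = timeMean(sin T_j), Y_T = nu_j k^2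
timeMean(sin A_j), both bounded in T (sup_t ||u_j(t)|| < infinity); limsup(X+Y) >= limsup X - limsup
|Y| and |timeMean(sin A_j)| <= (timeMean A_j^2)^(1/2) <= (timeMean ||u_j||^2 / 2)^(1/2), so
limsup-mean W_j >= (F/omega) eps0 - (F/omega) nu_j k^2 (E/2)^(1/2) >= (F/omega) eps0/2 =: eps for j
>= j0 (nu_j -> 0); no-leakage turns this into meanDissipation(nu_j, u_j) >= eps; reindex the family
by j -> j + j0 (all clauses are shift-invariant, Tendsto nu (. + j0) -> 0). Needs 0 < F, 0 < omega.
Sources: folklore; Mathlib Filter.limsup_add_le-type lemmas / Real limsup of bounded sequences. -/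
@[route_item "route-AnomalousDissipation-ClockedKolmogorov"]
def CruxesGiveTarget : Prop :=
  QuadratureStressFloor → LoudFamiliesStayBounded → QuadratureWorkIdentity → ClockedKolmogorovZerothLaw

/-- item stmt-AnomalousDissipation-1484 · support · rank 9 · closed · moot by None · by planner
sources: ZerothLaw.lean:354 Literature.Analysis.FluidPDE.ZerothLawTimePeriodic
[support] GLUE (target -> milestone): ForceAdmissible -> ClockedKolmogorovZerothLaw ->
Literature.Analysis.FluidPDE.ZerothLawTimePeriodic. Unpack F, omega, m and the family; the force of
S03 is literally the clocked Kolmogorov force (same lambda term), tau := 2 pi / omega > 0;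
smooth/periodic/div-free/mean-zero from ForceAdmissible F omega m (0 < omega); remaining clauses
copied. ~30 lines. [folklore] -/
@[route_item "route-AnomalousDissipation-ClockedKolmogorov"]
def TargetGivesS03 : Prop :=
  ForceAdmissible → ClockedKolmogorovZerothLaw → Literature.Analysis.FluidPDE.ZerothLawTimePeriodic

/-- item stmt-AnomalousDissipation-1485 · assembly · rank 1 · closed · moot by None · by planner
sources: BrueDeLellis2023, Cheskidov2023
[assembly] QuadratureStressFloor -> LoudFamiliesStayBounded -> QuadratureWorkIdentity ->
ForceAdmissible -> Literature.Analysis.FluidPDE.ZerothLawTimePeriodic: composition of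
CruxesGiveTarget and TargetGivesS03 (MILESTONE assembly to the registered open statement turb.S03,
which the summit implies: InterimFluidKinetic.ZerothLawTimePeriodicStmt, closed). One line once the
two glue items are proved; may also be proved directly. -/
@[route_item "route-AnomalousDissipation-ClockedKolmogorov"]
def Assembly : Prop :=
  QuadratureStressFloor → LoudFamiliesStayBounded → QuadratureWorkIdentity → ForceAdmissible → Literature.Analysis.FluidPDE.ZerothLawTimePeriodic

end Summit.AnomalousDissipation.AnomalousDissipation.Theses.ClockedKolmogorov
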